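import Summits.QuantumFields.BalabanUV.Beta.EriceFlowEnclosureB12AsPrintedHistoryUniformDepth

/-!
# Beta / EriceFlowEnclosureB12AsPrintedHistoryContagion — ASYMPTOTIC FREEDOM IS CONTAGIOUS under coupling-chart history moduli with
# FADING MEMORY, part 1 (the comparison kernel): subtracting the printed recursion (0.20) along ANY run A and along ONE reference run T of
# the same depth, the moduli bound the difference of the two displacements over [j, K) by a CONSTANT for the old history (fading memory)
# plus the recent envelopes of A and T (β-flow team, prover 1 = recursion ∕ upper ∕ bare-coupling ∕ UNIQUENESS side, unit
# `b2b-balaban-beta-bflow-p1`, gen 35; ROW AP-I·U, fourth reading; part 2 `…HistoryContagionProfile` = the contagion proper (every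
# small-endpoint run stays below twice its endpoint, carries (0.31)'s lower half at a quarter of the reference rate, and same-depth runs pinned
# at the same small coupling COINCIDE — no AF letter, no sign letter, no g-uniform Theorem 2, no box-versus-rate smallness), part 3
# `…HistoryContagionEnd` = carrier ∕ Theorem-2-AS-TYPED ENDs and the two load-bearing inputs; companions: gen 33 `…HistoryUnique` (uniqueness
# GIVEN the AF letter `BetaLowerH b` and `C(γ³ + 2γ∕b) ≤ (1 − θ)∕2`), gen 34 `…HistoryUniformDepth` ∕ `…HistoryNonunique*` (θ = 1: depth-limited,
# false beyond), prover 2's gen 43 `…PointwiseFading` (uniqueness near zero GIVEN the g-UNIFORM Theorem 2, comparison runs confined to ]0, g₂]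
# with `g₂C∕(1 − θ) ≤ b∕2`) and its OPEN (b) «is the uniform reading load-bearing for uniqueness?» — answered in part 3: NO)

HONEST FRAMING (page 1 of everything the β sub-cell writes): discharging `BetaPertH` makes Bałaban's UV stability UNCONDITIONAL — a
real constructive-QFT result; it is NOT the continuum limit and NOT the Clay problem.  HONEST DEPENDENCY (cell reorg 2026-08-19,
verbatim): «continuum YM on T⁴ ⇐ BetaPertH ∧ nine spine estimates (0/9 proved); BetaPertH ⇐ (D1) ∧ (D4) ∧ CAP+tail; G-an2-4 gates
asym, D1 and NE2/3/4.»  THIS MODULE DISCHARGES NOTHING: [folklore] finite-sum calculus over runs of the printed recursion (0.20)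
(`FlowStep.RGEqH`, history-dependent β on an abstract `Setting S` of the statement-exact typing `B12BetaAsPrinted` of [I] = T. Bałaban,
Commun. Math. Phys. **109** (1987) [Balaban1987RG1]) under node U2's HYPOTHESIS SHAPES `T4CouplingMatching.HistLipschitz Λ γ β`
(|β_{l+1}(p) − β_{l+1}(q)| ≤ Σ_i Λ l i |p_i − q_i| on ]0, γ]^{l+1}) and `FadingMemory C θ Λ` (0 ≤ Λ l i ≤ Cθ^{l−i}) — NOT PRINTED ([I] p. 298 says
only that β_j *"depends also on all preceding coupling constants"*; GAPS G-t4-U2-2) — and a reference run obeying (0.31)'s LOWER HALF from its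
own end (`1∕t_K² + β*(K − i) ≤ 1∕t_i²`, the shape `Step.Discrete031` which [I] Theorem 2 p. 259 — STATED WITHOUT PROOF — asserts for its tuned
run).  Every letter is a hypothesis; nothing of Bałaban's β is asserted.

THE POINT.  Gen 33's `runs_eq_of_fadingMemory` makes two same-depth runs pinned at the same renormalized coupling coincide once the AF
weight sum Σ_i g_i² g′_i is small, and read that sum off the AF LETTER `b ≤ β` on the whole box; prover 2's part 6 read it off (0.31) along
Theorem 2's OWN tuned run at the SAME endpoint, which under the TYPED Theorem 2 (constants β(g) chosen after g, `Missing.B12Thm2Shape`) cannot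
serve near zero.  The way out: compare a run A of depth K in ]0, γ] with a reference run T of the SAME depth ending ANYWHERE (at t_K, rate β*).
At one scale l (§2 `rate_abs_le_of_reference`) the moduli bound |β_{l+1}(A_{≤l}) − β_{l+1}(T_{≤l})| by the OLD history (coordinates i ≤ j: each
≤ γ, discounted by θ^{l−i}: ≤ Cγθ^{l−j}∕(1 − θ)) plus the RECENT one (j < i ≤ l: ≤ (C∕(1 − θ))(E + F) for envelopes A_i ≤ E, T_i ≤ F); summed over
l ∈ [j, K) and telescoped (§2 `disp_abs_le_of_reference`) the two displacements 1∕A_j² − 1∕A_K² and 1∕T_j² − 1∕T_K² differ by at most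
**Cγ∕(1 − θ)² + (C∕(1 − θ))(E(K − j) + Σ_l F_l)** — the whole unknown deep history costs a CONSTANT (Σ_l θ^{l−j} ≤ 1∕(1 − θ): this is where fading
memory works, and where θ = 1 would give a term growing with the depth — gen 34).  §1 supplies the geometric rows and the reference profile
in node U2's `prof ∕ sprof` language (T_i ≤ 1∕√a_{K−l} for i ≤ l, Σ_l 1∕√a_{K−l} ≤ t_K + (2∕β*)√a_{K−j} by gen 34's `sum_invSprof_le`, and the
absorption c·√a ≤ c² + a∕4 used in part 2).

WHAT THIS FILE PROVES (0 sorry, 0 def):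
§1 `geom_old_le`, `geom_recent_le`, `geom_shift_le`, `sprof_le_sprof`, `mul_sprof_le`, `ref_le_invSprof`, `sum_invSprof_Ico_le`.
§2 **`rate_abs_le_of_reference`**, **`disp_abs_le_of_reference`**.
NOT CLAIMED: any modulus, sign or bound for Bałaban's β; Theorem 2; `BetaPertH`; continuum; Clay.
-/

namespace Summit.QuantumFields.BalabanUV.Beta.EriceFlowEnclosureB12AsPrintedHistoryContagion

open Finset
open Literature.MathematicalPhysics.QuantumFieldTheory.Balaban1983to89
open Literature.MathematicalPhysics.QuantumFieldTheory.Balaban1983to89.B12BetaAsPrinted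
open Literature.MathematicalPhysics.QuantumFieldTheory.Balaban1983to89.FlowStep (prefixOf Box mem_box box_mono RGEqH)
open Literature.MathematicalPhysics.QuantumFieldTheory.Balaban1983to89.T4CouplingMatching (HistLipschitz FadingMemory prof sprof
  sprof_pos sprof_sq prof_pos sprof_zero sum_profWeights_le)
open Summit.QuantumFields.BalabanUV.Beta.EriceFlowEnclosureB12AsPrintedHistoryUnique (runs_eq_of_fadingMemory)
open Summit.QuantumFields.BalabanUV.Beta.EriceFlowEnclosureB12AsPrintedHistoryUniformDepth (sum_invSprof_le)

noncomputable section

variable {S : Setting}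

/-! ## §1 Bookkeeping: geometric rows, the reference profile, the square-root absorption -/

/-- Old-history row: `Σ_{i ≤ j} θ^{l−i} ≤ θ^{l−j}∕(1 − θ)` for j ≤ l, 0 ≤ θ < 1. [folklore] -/
theorem geom_old_le {θ : ℝ} (hθ0 : 0 ≤ θ) (hθ1 : θ < 1) {j l : ℕ} (hjl : j ≤ l) :
    ∑ i ∈ range (j + 1), θ ^ (l - i) ≤ θ ^ (l - j) / (1 - θ) := by
  have h1 : ∑ i ∈ range (j + 1), θ ^ (l - i) = θ ^ (l - j) * ∑ i ∈ range (j + 1), θ ^ (j + 1 - 1 - i) := by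
    rw [Finset.mul_sum]
    refine Finset.sum_congr rfl fun i hi => ?_
    have hij : i ≤ j := Nat.lt_succ_iff.mp (mem_range.mp hi)
    rw [← pow_add]
    congr 1
    omega
  rw [h1, Finset.sum_range_reflect (fun i => θ ^ i) (j + 1)]
  have h2 : ∑ i ∈ range (j + 1), θ ^ i ≤ 1 / (1 - θ) := by
    have h := geom_sum_Ico_le_of_lt_one (m := 0) (n := j + 1) hθ0 hθ1
    rwa [Nat.Ico_zero_eq_range, pow_zero] at h
  rw [div_eq_mul_one_div]
  exact mul_le_mul_of_nonneg_left h2 (pow_nonneg hθ0 _)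

/-- Recent-history row: `Σ_{j < i ≤ l} θ^{l−i} ≤ 1∕(1 − θ)`. [folklore] -/
theorem geom_recent_le {θ : ℝ} (hθ0 : 0 ≤ θ) (hθ1 : θ < 1) (j l : ℕ) :
    ∑ i ∈ Ico (j + 1) (l + 1), θ ^ (l - i) ≤ 1 / (1 - θ) := by
  calc ∑ i ∈ Ico (j + 1) (l + 1), θ ^ (l - i) ≤ ∑ i ∈ range (l + 1), θ ^ (l - i) :=
        Finset.sum_le_sum_of_subset_of_nonneg (fun i hi => mem_range.mpr (mem_Ico.mp hi).2)
          (fun i _ _ => pow_nonneg hθ0 _)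
    _ ≤ θ ^ (l - l) / (1 - θ) := geom_old_le hθ0 hθ1 le_rfl
    _ = 1 / (1 - θ) := by rw [Nat.sub_self, pow_zero]

/-- The discounts of the old history summed over the scales: `Σ_{l ∈ [j, K)} θ^{l−j} ≤ 1∕(1 − θ)`. [folklore] -/
theorem geom_shift_le {θ : ℝ} (hθ0 : 0 ≤ θ) (hθ1 : θ < 1) (j K : ℕ) :
    ∑ l ∈ Ico j K, θ ^ (l - j) ≤ 1 / (1 - θ) := by
  rw [Finset.sum_Ico_eq_sum_range]
  have h : ∑ d ∈ range (K - j), θ ^ (j + d - j) = ∑ d ∈ range (K - j), θ ^ d :=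
    Finset.sum_congr rfl fun d _ => by rw [Nat.add_sub_cancel_left]
  rw [h]
  have h2 := geom_sum_Ico_le_of_lt_one (m := 0) (n := K - j) hθ0 hθ1
  rwa [Nat.Ico_zero_eq_range, pow_zero] at h2

/-- `√a_m ≤ √a_n` for m ≤ n (the AF comparison profile is monotone). [folklore] -/
theorem sprof_le_sprof {γ b : ℝ} (hb : 0 ≤ b) {m n : ℕ} (h : m ≤ n) : sprof γ b m ≤ sprof γ b n := by
  unfold T4CouplingMatching.sprof T4CouplingMatching.prof
  exact Real.sqrt_le_sqrt (by gcongr)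

/-- The square-root absorption: `c·√a_n ≤ c² + a_n∕4`. [folklore] -/
theorem mul_sprof_le {γ b : ℝ} (hγ : 0 < γ) (hb : 0 ≤ b) (c : ℝ) (n : ℕ) :
    c * sprof γ b n ≤ c ^ 2 + prof γ b n / 4 := by
  have hs := sprof_sq hγ hb n
  nlinarith [sq_nonneg (c - sprof γ b n / 2)]

/-- **The reference run under its own (0.31) profile.**  If `1∕t_K² + β*(K − i) ≤ 1∕t_i²` for i ≤ K (the lower half of `Step.Discrete031` from
the endpoint t_K, β* > 0), then `t_i ≤ 1∕√a_{K−l}` for every i ≤ l ≤ K, a_m = 1∕t_K² + β*·m. [cite: Balaban1987RG1, Thm 2 (0.31) p.259] -/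
theorem ref_le_invSprof {bs : ℝ} {K : ℕ} {t : ℕ → ℝ} (hbs : 0 < bs) (hpos : ∀ i, i ≤ K → 0 < t i)
    (h031 : ∀ i, i ≤ K → 1 / (t K) ^ 2 + bs * ((K : ℝ) - i) ≤ 1 / (t i) ^ 2) {i l : ℕ} (hil : i ≤ l) (hlK : l ≤ K) :
    t i ≤ 1 / sprof (t K) bs (K - l) := by
  have hiK : i ≤ K := hil.trans hlK
  have htK := hpos K le_rfl
  have hti := hpos i hiK
  have hp0 := sprof_pos htK hbs.le
  have ha : prof (t K) bs (K - i) ≤ 1 / (t i) ^ 2 := by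
    unfold T4CouplingMatching.prof
    rw [Nat.cast_sub hiK]
    exact h031 i hiK
  have hsq : (t i) ^ 2 ≤ (1 / sprof (t K) bs (K - i)) ^ 2 := by
    rw [one_div_pow, sprof_sq htK hbs.le, le_one_div (pow_pos hti 2) (prof_pos htK hbs.le _)]
    exact ha
  have h1 : t i ≤ 1 / sprof (t K) bs (K - i) :=
    (pow_le_pow_iff_left₀ hti.le (one_div_pos.mpr (hp0 _)).le two_ne_zero).mp hsq
  exact h1.trans (one_div_le_one_div_of_le (hp0 _) (sprof_le_sprof hbs.le (by omega)))

/-- The recent-history bound of the reference run summed over the scales: `Σ_{l ∈ [j, K)} 1∕√a_{K−l} ≤ g* + (2∕β*)√a_{K−j}` — gen 34's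
`sum_invSprof_le` (node U2's profile telescoped one order up) after reindexing. [folklore] -/
theorem sum_invSprof_Ico_le {gs bs : ℝ} (hgs : 0 < gs) (hbs : 0 < bs) {j K : ℕ} (hjK : j ≤ K) :
    ∑ l ∈ Ico j K, 1 / sprof gs bs (K - l) ≤ gs + 2 / bs * sprof gs bs (K - j) := by
  have h1 : ∑ l ∈ Ico j K, 1 / sprof gs bs (K - l) = ∑ m ∈ Ico (K + 1 - K) (K + 1 - j), 1 / sprof gs bs m :=
    Finset.sum_Ico_reflect (fun m => 1 / sprof gs bs m) j (Nat.le_succ K)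
  have h2 : ∑ m ∈ Ico (K + 1 - K) (K + 1 - j), 1 / sprof gs bs m ≤ ∑ m ∈ range (K - j + 1), 1 / sprof gs bs m :=
    Finset.sum_le_sum_of_subset_of_nonneg (fun m hm => mem_range.mpr (by have := (mem_Ico.mp hm).2; omega))
      (fun m _ _ => (one_div_pos.mpr (sprof_pos hgs hbs.le m)).le)
  rw [h1]
  exact h2.trans (sum_invSprof_le hgs hbs (K - j))

/-! ## §2 One reference run: the rate comparison at one scale and the displacement comparison over [j, K) -/

/-- **THE RATE COMPARISON AT ONE SCALE.**  Two histories of length l + 1 in the box ]0, γ] — a run A (`g`) and a reference run T (`t`) —,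
coupling-chart moduli `HistLipschitz Λ γ S.β` with `FadingMemory C θ Λ` (0 ≤ θ < 1): if the RECENT coordinates j < i ≤ l of A are ≤ E and all
coordinates i ≤ l of T are ≤ F (E, F ≥ 0), then `|β_{l+1}(A_{≤l}) − β_{l+1}(T_{≤l})| ≤ Cγθ^{l−j}∕(1 − θ) + (C∕(1 − θ))(E + F)`: the OLD
coordinates i ≤ j differ by at most γ but are discounted by θ^{l−i}, the recent ones by at most E + F. [cite: Balaban1987RG1, (0.20) p.256 with p.298] -/
theorem rate_abs_le_of_reference {γ θ C E F : ℝ} {Λ : ℕ → ℕ → ℝ} {K j l : ℕ} {g t : ℕ → ℝ}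
    (hθ0 : 0 ≤ θ) (hθ1 : θ < 1) (hC : 0 ≤ C) (hL : HistLipschitz Λ γ S.β) (hΛ : FadingMemory C θ Λ)
    (hbox : ∀ i, i ≤ K → 0 < g i ∧ g i ≤ γ) (hboxt : ∀ i, i ≤ K → 0 < t i ∧ t i ≤ γ)
    (hjl : j ≤ l) (hlK : l ≤ K) (hE0 : 0 ≤ E) (hF0 : 0 ≤ F)
    (hE : ∀ i, j < i → i ≤ l → g i ≤ E) (hF : ∀ i, i ≤ l → t i ≤ F) :
    |S.β l (prefixOf g l) - S.β l (prefixOf t l)| ≤ C * γ * θ ^ (l - j) / (1 - θ) + C / (1 - θ) * (E + F) := by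
  have hγ : 0 ≤ γ := (hbox 0 (Nat.zero_le _)).1.le.trans (hbox 0 (Nat.zero_le _)).2
  have h1θ : 0 < 1 - θ := by linarith
  have hp : prefixOf g l ∈ Box γ l := T4CouplingMatching.prefixOf_mem_box hlK hbox
  have hpt : prefixOf t l ∈ Box γ l := T4CouplingMatching.prefixOf_mem_box hlK hboxt
  have h1 := hL l _ _ hp hpt
  have h2 : ∑ i : Fin (l + 1), Λ l i * |prefixOf g l i - prefixOf t l i| = ∑ i ∈ range (l + 1), Λ l i * |g i - t i| := by
    simp only [FlowStep.prefixOf_apply]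
    exact Fin.sum_univ_eq_sum_range (fun i => Λ l i * |g i - t i|) (l + 1)
  have hold : ∀ i ∈ range (j + 1), Λ l i * |g i - t i| ≤ C * γ * θ ^ (l - i) := by
    intro i hi
    have hij : i ≤ j := Nat.lt_succ_iff.mp (mem_range.mp hi)
    have hiK : i ≤ K := hij.trans (hjl.trans hlK)
    have hgt : |g i - t i| ≤ γ := by
      rw [abs_sub_le_iff]
      constructor <;> linarith [(hbox i hiK).1, (hbox i hiK).2, (hboxt i hiK).1, (hboxt i hiK).2]
    have hΛi := hΛ l i (hij.trans hjl)
    calc Λ l i * |g i - t i| ≤ (C * θ ^ (l - i)) * γ := mul_le_mul hΛi.2 hgt (abs_nonneg _) (by positivity)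
      _ = C * γ * θ ^ (l - i) := by ring
  have hnew : ∀ i ∈ Ico (j + 1) (l + 1), Λ l i * |g i - t i| ≤ C * (E + F) * θ ^ (l - i) := by
    intro i hi
    obtain ⟨hji, hil⟩ := mem_Ico.mp hi
    have hil' : i ≤ l := Nat.lt_succ_iff.mp hil
    have hiK : i ≤ K := hil'.trans hlK
    have hgt : |g i - t i| ≤ E + F := by
      rw [abs_sub_le_iff]
      constructor <;> linarith [(hbox i hiK).1, (hboxt i hiK).1, hE i (by omega) hil', hF i hil']
    have hΛi := hΛ l i hil'
    calc Λ l i * |g i - t i| ≤ (C * θ ^ (l - i)) * (E + F) := mul_le_mul hΛi.2 hgt (abs_nonneg _) (by positivity)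
      _ = C * (E + F) * θ ^ (l - i) := by ring
  have hsplit := Finset.sum_range_add_sum_Ico (fun i => Λ l i * |g i - t i|) (show j + 1 ≤ l + 1 by omega)
  have hA : ∑ i ∈ range (j + 1), Λ l i * |g i - t i| ≤ C * γ * θ ^ (l - j) / (1 - θ) := by
    calc ∑ i ∈ range (j + 1), Λ l i * |g i - t i| ≤ ∑ i ∈ range (j + 1), C * γ * θ ^ (l - i) := Finset.sum_le_sum hold
      _ = C * γ * ∑ i ∈ range (j + 1), θ ^ (l - i) := by rw [Finset.mul_sum]
      _ ≤ C * γ * (θ ^ (l - j) / (1 - θ)) := mul_le_mul_of_nonneg_left (geom_old_le hθ0 hθ1 hjl) (by positivity)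
      _ = C * γ * θ ^ (l - j) / (1 - θ) := by ring
  have hB : ∑ i ∈ Ico (j + 1) (l + 1), Λ l i * |g i - t i| ≤ C / (1 - θ) * (E + F) := by
    calc ∑ i ∈ Ico (j + 1) (l + 1), Λ l i * |g i - t i| ≤ ∑ i ∈ Ico (j + 1) (l + 1), C * (E + F) * θ ^ (l - i) :=
          Finset.sum_le_sum hnew
      _ = C * (E + F) * ∑ i ∈ Ico (j + 1) (l + 1), θ ^ (l - i) := by rw [Finset.mul_sum]
      _ ≤ C * (E + F) * (1 / (1 - θ)) := mul_le_mul_of_nonneg_left (geom_recent_le hθ0 hθ1 j l) (by positivity)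
      _ = C / (1 - θ) * (E + F) := by ring
  rw [h2, ← hsplit] at h1
  linarith

/-- **THE DISPLACEMENT COMPARISON OVER [j, K).**  Two runs of (0.20) of the same depth K with the same β (`FlowStep.RGEqH`), couplings in ]0, γ],
moduli as above; A_i ≤ E for j < i ≤ K, T_i ≤ F_l for i ≤ l, every l ∈ [j, K) (E, F_l ≥ 0).  Then, telescoping (0.20) along both runs
(`FlowStep.inv_sq_telescopeH`), **`|(1∕A_j² − 1∕A_K²) − (1∕T_j² − 1∕T_K²)| ≤ Cγ∕(1 − θ)² + (C∕(1 − θ))(E(K − j) + Σ_{l∈[j,K)} F_l)`** — the old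
history costs a CONSTANT (Σ_l θ^{l−j} ≤ 1∕(1 − θ)), the recent one a linear term plus the reference profile. [cite: Balaban1987RG1, (0.20) p.256 with p.298] -/
theorem disp_abs_le_of_reference {γ θ C E : ℝ} {F : ℕ → ℝ} {Λ : ℕ → ℕ → ℝ} {K j : ℕ} {g t : ℕ → ℝ}
    (hθ0 : 0 ≤ θ) (hθ1 : θ < 1) (hC : 0 ≤ C) (hL : HistLipschitz Λ γ S.β) (hΛ : FadingMemory C θ Λ)
    (hg : RGEqH K S.β g) (ht : RGEqH K S.β t)
    (hbox : ∀ i, i ≤ K → 0 < g i ∧ g i ≤ γ) (hboxt : ∀ i, i ≤ K → 0 < t i ∧ t i ≤ γ) (hjK : j ≤ K)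
    (hE0 : 0 ≤ E) (hE : ∀ i, j < i → i ≤ K → g i ≤ E)
    (hF0 : ∀ l, 0 ≤ F l) (hF : ∀ l i, j ≤ l → l < K → i ≤ l → t i ≤ F l) :
    |(1 / (g j) ^ 2 - 1 / (g K) ^ 2) - (1 / (t j) ^ 2 - 1 / (t K) ^ 2)|
      ≤ C * γ / (1 - θ) ^ 2 + C / (1 - θ) * (E * ((K : ℝ) - j) + ∑ l ∈ Ico j K, F l) := by
  have hγ : 0 ≤ γ := (hbox 0 (Nat.zero_le _)).1.le.trans (hbox 0 (Nat.zero_le _)).2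
  have h1θ : 0 < 1 - θ := by linarith
  have hpt : ∀ l ∈ Ico j K, |S.β l (prefixOf g l) - S.β l (prefixOf t l)|
      ≤ C * γ / (1 - θ) * θ ^ (l - j) + (C / (1 - θ) * E + C / (1 - θ) * F l) := by
    intro l hl
    obtain ⟨hjl, hlK⟩ := mem_Ico.mp hl
    have h := rate_abs_le_of_reference hθ0 hθ1 hC hL hΛ hbox hboxt hjl hlK.le hE0 (hF0 l)
      (fun i hji hil => hE i hji (hil.trans hlK.le)) (fun i hil => hF l i hjl hlK hil)
    have e : C * γ * θ ^ (l - j) / (1 - θ) + C / (1 - θ) * (E + F l)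
        = C * γ / (1 - θ) * θ ^ (l - j) + (C / (1 - θ) * E + C / (1 - θ) * F l) := by ring
    linarith
  have hsum : ∑ l ∈ Ico j K, |S.β l (prefixOf g l) - S.β l (prefixOf t l)|
      ≤ C * γ / (1 - θ) * ∑ l ∈ Ico j K, θ ^ (l - j)
        + (C / (1 - θ) * E * ((K - j : ℕ) : ℝ) + C / (1 - θ) * ∑ l ∈ Ico j K, F l) := by
    refine (Finset.sum_le_sum hpt).trans (le_of_eq ?_)
    rw [Finset.sum_add_distrib, Finset.sum_add_distrib, Finset.mul_sum, Finset.mul_sum, Finset.sum_const, Nat.card_Ico,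
      nsmul_eq_mul]
    ring
  have hgeo : C * γ / (1 - θ) * ∑ l ∈ Ico j K, θ ^ (l - j) ≤ C * γ / (1 - θ) * (1 / (1 - θ)) :=
    mul_le_mul_of_nonneg_left (geom_shift_le hθ0 hθ1 j K) (by positivity)
  have hcast : ((K - j : ℕ) : ℝ) = (K : ℝ) - j := Nat.cast_sub hjK
  have htel : (1 / (g j) ^ 2 - 1 / (g K) ^ 2) - (1 / (t j) ^ 2 - 1 / (t K) ^ 2)
      = ∑ l ∈ Ico j K, (S.β l (prefixOf g l) - S.β l (prefixOf t l)) := by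
    rw [Finset.sum_sub_distrib, FlowStep.inv_sq_telescopeH hg hjK le_rfl, FlowStep.inv_sq_telescopeH ht hjK le_rfl]
    ring
  rw [htel]
  refine (Finset.abs_sum_le_sum_abs _ _).trans ?_
  rw [hcast] at hsum
  have e2 : C * γ / (1 - θ) * (1 / (1 - θ)) = C * γ / (1 - θ) ^ 2 := by
    field_simp
  have e3 : C / (1 - θ) * E * ((K : ℝ) - j) + C / (1 - θ) * ∑ l ∈ Ico j K, F l
      = C / (1 - θ) * (E * ((K : ℝ) - j) + ∑ l ∈ Ico j K, F l) := by ring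
  linarith

end

end Summit.QuantumFields.BalabanUV.Beta.EriceFlowEnclosureB12AsPrintedHistoryContagion
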